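import Summits.BirchSwinnertonDyer.Rank1Residual.Additive.UnramifiedKummerDoorGeneric
import HarnessLib

set_option autoImplicit false
set_option linter.dupNamespace false

/-!
# Route `ErratumRoadFive`, crux 19715 `EulerHalfNotRamNoInertSetAtFive`, line `kato_Fframe` (r5.4), stub S1Λ
# `stub_katoLambdaLogBoundTamagawa` — HELPER (residual R-C, generic part): the unramified/Kummer DOOR WITH A LIFT,
# `H¹(i)⁻¹(H¹_ur(F, B)) = H¹_ur(F, A) ⊔ ker H¹(i)` WITHOUT the inertia-torsion hypothesis

Seat `bsd-idea-9` (planner/ideator, g40), `--supports stmt-BirchSwinnertonDyer-19715` as HELPER; design note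
`Cruxes/EulerHalfNotRamNoInertSetAtFive/Lines/kato_Fframe_r5_S1Lambda_level0_RC.md` §3 (D), §4 file 1 (LEAD
`bsd-line-er5-p1` g8 owns residual R-C; this file is the curve-free generic lemma only). W-79: no registration
touched; theorems only (no `def`, no named fact, no instance, no notation, no `sorry`).

WHAT.  `F` a non-archimedean local field, `i : A ↪ B` an injective intertwining map of discrete `Γ_F`-modules
with `range i ⊇ B[n]` (Kummer-type: `E[p^k] ↪ E[p^∞]`), `I_F = absInertia F`.  Team n1011's door
`Additive.comap_map_unramifiedSubgroup_eq_sup_ker_of_inertia_torsion` proves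
`H¹(i)⁻¹(H¹_ur(F, B)) = H¹_ur(F, A) ⊔ ker H¹(i)` under `hI`: «every `I_F`-fixed point of `B` is killed by `n`»
— true for `E[p^∞]` at an ADDITIVE `v ∤ p` (`p` odd), false at a multiplicative one (`μ_{p^∞} ⊗ χ ⊂ E[p^∞]^{I_v}`).
Here the SAME conclusion is proved under the weaker, reduction-type-free hypothesis
`hlift`: «every `I_F`-fixed `y ∈ B` whose class in `B^{I_F} / n • B^{I_F}` is `Γ_F`-fixed is congruent modulo
`n • B^{I_F}` to a `Γ_F`-fixed point» (for `B = E[p^∞]`, `n = p^k`, `k ≫ 0` this is «`E(K_v)[p^∞]` reaches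
`(E(K_v^nr)[p^∞] / p^k)^{Frob}`», a consequence of «rational `p`-power torsion reaches `Φ_v(k_v)[p^∞]`» and the
`p`-divisibility of `E₀(K_v^nr)[p^∞]`; that arithmetic discharge is NOT in this file):

* §1 `mem_unramifiedSubgroup_sup_ker_map_of_principal_on_absInertia_of_nsmul_fixed` — the core of n1011's
  proof isolated: if `i ∘ φ` is principal on `I_F` with witness `b` (`i (φ τ) = τ b − b`) and `n • b ∈ B^{Γ_F}`, then
  `[φ] = [φ − lift(σ ↦ σ b − b)] + δ(b) ∈ H¹_ur(F, A) ⊔ ker H¹(i)` (no torsion hypothesis at all);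
* §2 `exists_principal_witness_nsmul_fixed_of_lift` — under `hlift` (and `n • A = 0`) the witness `b` can be
  CORRECTED by an `I_F`-fixed element to one with `n • b ∈ B^{Γ_F}`: the defect cocycle
  `ψ σ = i (φ σ) − (σ b − b)` is `B^{I_F}`-valued (normality of `I_F`), so `y = n • b ∈ B^{I_F}` has
  `σ y − y = −n • ψ σ ∈ n • B^{I_F}`; `hlift` gives `y − m = n • z`, and `b − z` is the corrected witness;
* §3 `mem_unramifiedSubgroup_sup_ker_map_of_principal_on_absInertia_of_lift`,
  **`comap_map_unramifiedSubgroup_eq_sup_ker_of_lift`** (the door), and `lift_of_inertia_torsion`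
  (`hI ⟹ hlift`, so n1011's door is the special case).

HONEST LABEL: helper theorems in local Galois cohomology; no stub or item is closed; nothing is registered; S1Λ and
residual R-C are NOT proved here; BSD is proved for no curve.
References: [MilneADT2006] Ch. I §2 (unramified cohomology `H¹(G/I, M^I)`) and Prop. 3.8; [GreenbergLNM1716] §2
pp. 72–74; [SerreGaloisCohomology1997] I §5.1.
-/

noncomputable section

open scoped Classical ContRepresentation

open CategoryTheory Field ValuativeRel Function
open Literature.NumberTheory.GaloisRepresentations
  Literature.NumberTheory.GaloisRepresentations.IsNonarchimedeanLocalField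
open Summit.BirchSwinnertonDyer.Rank1Residual.X11b
open Summit.BirchSwinnertonDyer.Rank1Residual.Additive

namespace Summit.BirchSwinnertonDyer.BirchSwinnertonDyer.Theorems.ErratumRoadFiveKatoFframeDoorLift

universe u

variable {F : Type u} [Field F] [ValuativeRel F] [TopologicalSpace F] [IsNonarchimedeanLocalField F]
  {A B : Type u} [AddCommGroup A] [TopologicalSpace A] [DiscreteTopology A]
  [AddCommGroup B] [TopologicalSpace B] [DiscreteTopology B]
  {ρA : DiscreteGaloisModule F A} {ρB : DiscreteGaloisModule F B}

/-! ### §1 The core: a principal-on-inertia witness `b` with `n • b ∈ B^{Γ_F}` -/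

/-- **`[φ] ∈ H¹_ur(F, A) ⊔ ker H¹(i)`** when `i ∘ φ` is principal on `I_F` with a witness `b` such that
`n • b` is `Γ_F`-fixed (`i : A ↪ B` injective, `range i ⊇ B[n]`): `[φ] = [φ − lift(σ ↦ σ b − b)] + δ(b)`, the first
class vanishing identically on `I_F`, the second the connecting class of `n • b`, which dies under `H¹(i)`.  No
torsion hypothesis. [cite: MilneADT2006, Ch. I §2 and Prop. 3.8] [cite: GreenbergLNM1716, §2, pp. 72–74] -/
theorem mem_unramifiedSubgroup_sup_ker_map_of_principal_on_absInertia_of_nsmul_fixed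
    {i : ρA.toContRepresentation →ⁱL ρB.toContRepresentation} {n : ℕ}
    (hrange : ∀ b : B, n • b = 0 → ∃ a : A, i a = b) (hinj : Function.Injective i)
    (φ : contOneCocycles ρA.toTopRep) {b : B}
    (hb : ∀ τ ∈ absInertia F, i (φ.1 τ) = ρB τ b - b)
    (hbn : ∀ σ : absoluteGaloisGroup F, ρB σ (n • b) = n • b) :
    oneCocycleClass ρA.toTopRep φ ∈
      DiscreteGaloisModule.unramifiedSubgroup ρA 1 ⊔ (galoisCohomology.map i 1).ker := by
  refine AddSubgroup.mem_sup.mpr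
    ⟨oneCocycleClass ρA.toTopRep
      (φ - Levels.liftCocycle i n hrange hinj (Levels.cobCocycle ρB b)
        (Levels.nsmul_cobCocycle_apply_eq_zero n hbn)),
    ?_, Levels.connectingClass i n hrange hinj b hbn,
    (AddMonoidHom.mem_ker).mpr (Levels.map_connectingClass hinj b hbn), ?_⟩
  · -- `φ - lift(σ ↦ σ b - b)` vanishes identically on `I_F`
    refine (LocBridge.mem_unramifiedSubgroup_one_iff_exists ρA _).mpr ⟨0, fun τ hτ ↦ ?_⟩
    rw [map_zero, sub_zero, contOneCocycles_sub_apply]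
    apply hinj
    rw [map_sub, Levels.apply_liftCocycle hinj (Levels.cobCocycle ρB b)
      (Levels.nsmul_cobCocycle_apply_eq_zero n hbn), Levels.cobCocycle_apply, hb τ hτ, sub_self,
      map_zero]
  · rw [oneCocycleClass_sub, Levels.connectingClass, sub_add_cancel]

/-! ### §2 Correcting the witness under the lift hypothesis -/

/-- **The defect cocycle is inertia-fixed.** If `i (φ τ) = τ b − b` on `I_F`, then for every `σ ∈ Γ_F` the element
`i (φ σ) − (σ b − b)` is fixed by `I_F` (`I_F` is normal in `Γ_F`; n1011's computation, isolated). [folklore] -/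
theorem absInertia_fixed_defect {i : ρA.toContRepresentation →ⁱL ρB.toContRepresentation}
    (φ : contOneCocycles ρA.toTopRep) {b : B} (hb : ∀ τ ∈ absInertia F, i (φ.1 τ) = ρB τ b - b)
    (σ : absoluteGaloisGroup F) :
    ∀ τ ∈ absInertia F, ρB τ (i (φ.1 σ) - (ρB σ b - b)) = i (φ.1 σ) - (ρB σ b - b) := by
  have hmulB : ∀ (g h : absoluteGaloisGroup F) (x : B), ρB (g * h) x = ρB g (ρB h x) :=
    fun g h x ↦ by rw [map_mul, Module.End.mul_apply]
  have hcoc : ∀ g h : absoluteGaloisGroup F, i (φ.1 (g * h)) = i (φ.1 g) + ρB g (i (φ.1 h)) := by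
    intro g h
    rw [φ.2 g h, map_add]
    congr 1
    exact i.isIntertwining g (φ.1 h)
  intro τ hτ
  have hτ' : σ⁻¹ * τ * σ ∈ absInertia F := by
    have h := (inferInstance : (absInertia F).Normal).conj_mem τ hτ σ⁻¹
    rwa [inv_inv] at h
  have e1 := hcoc τ σ
  have e2 := hcoc σ (σ⁻¹ * τ * σ)
  have hmul : σ * (σ⁻¹ * τ * σ) = τ * σ := by
    simp only [← mul_assoc, mul_inv_cancel, one_mul]
  rw [hmul, hb _ hτ', map_sub, ← hmulB, hmul, hmulB] at e2
  rw [hb τ hτ] at e1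
  have key : ρB τ (i (φ.1 σ)) = i (φ.1 σ) + (ρB τ (ρB σ b) - ρB σ b) - (ρB τ b - b) :=
    eq_sub_of_add_eq' (e1.symm.trans e2)
  rw [map_sub, map_sub, key]
  abel

/-- **Witness correction.** `A` killed by `n`, `i (φ τ) = τ b − b` on `I_F`, and the LIFT hypothesis `hlift`
(every `I_F`-fixed `y` with `σ y − y ∈ n • B^{I_F}` for all `σ` is `≡` a `Γ_F`-fixed point modulo `n • B^{I_F}`):
then there is a witness `b'` (namely `b − z`, `z ∈ B^{I_F}`) with `i (φ τ) = τ b' − b'` on `I_F` AND `n • b' ∈ B^{Γ_F}`.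
(`y = n • b` is `I_F`-fixed since `n • i(φ τ) = 0`, and `σ y − y = n • (σ b − b) = −n • ψ σ` with the defect `ψ σ`
inertia-fixed.) [cite: GreenbergLNM1716, §2, pp. 72–74] [cite: MilneADT2006, Ch. I Prop. 3.8] -/
theorem exists_principal_witness_nsmul_fixed_of_lift
    {i : ρA.toContRepresentation →ⁱL ρB.toContRepresentation} {n : ℕ}
    (hA : ∀ a : A, n • a = 0)
    (hlift : ∀ y : B, (∀ τ ∈ absInertia F, ρB τ y = y) →
      (∀ σ : absoluteGaloisGroup F, ∃ z : B, (∀ τ ∈ absInertia F, ρB τ z = z) ∧ ρB σ y - y = n • z) →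
      ∃ m : B, (∀ σ : absoluteGaloisGroup F, ρB σ m = m) ∧
        ∃ z : B, (∀ τ ∈ absInertia F, ρB τ z = z) ∧ y - m = n • z)
    (φ : contOneCocycles ρA.toTopRep) {b : B}
    (hb : ∀ τ ∈ absInertia F, i (φ.1 τ) = ρB τ b - b) :
    ∃ b' : B, (∀ τ ∈ absInertia F, i (φ.1 τ) = ρB τ b' - b') ∧
      ∀ σ : absoluteGaloisGroup F, ρB σ (n • b') = n • b' := by
  -- `y = n • b` is inertia-fixed
  have hyI : ∀ τ ∈ absInertia F, ρB τ (n • b) = n • b := by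
    intro τ hτ
    have h0 : n • (ρB τ b - b) = 0 := by rw [← hb τ hτ, ← map_nsmul i, hA, map_zero]
    rwa [smul_sub, ← map_nsmul (ρB τ), sub_eq_zero] at h0
  -- `σ y - y = n • (-(ψ σ))`, `ψ σ` the inertia-fixed defect
  have hyσ : ∀ σ : absoluteGaloisGroup F, ∃ z : B, (∀ τ ∈ absInertia F, ρB τ z = z) ∧
      ρB σ (n • b) - n • b = n • z := by
    intro σ
    refine ⟨-(i (φ.1 σ) - (ρB σ b - b)), fun τ hτ ↦ ?_, ?_⟩
    · rw [map_neg, absInertia_fixed_defect φ hb σ τ hτ]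
    · have h1 : n • i (φ.1 σ) = 0 := by rw [← map_nsmul i, hA, map_zero]
      rw [map_nsmul, smul_neg, smul_sub, smul_sub, h1, zero_sub, neg_neg]
  obtain ⟨m, hm, z, hz, hyz⟩ := hlift (n • b) hyI hyσ
  refine ⟨b - z, fun τ hτ ↦ ?_, fun σ ↦ ?_⟩
  · rw [map_sub, hb τ hτ, hz τ hτ]
    abel
  · have hnb : n • (b - z) = m := by rw [smul_sub, ← hyz]; abel
    rw [hnb, hm σ]

/-! ### §3 The door with a lift -/

/-- **`[φ] ∈ H¹_ur(F, A) ⊔ ker H¹(i)`** when `i ∘ φ` is principal on `I_F`, under the lift hypothesis (§2) in place of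
n1011's inertia-torsion hypothesis. [cite: MilneADT2006, Ch. I §2 and Prop. 3.8] [cite: GreenbergLNM1716, §2, pp. 72–74] -/
theorem mem_unramifiedSubgroup_sup_ker_map_of_principal_on_absInertia_of_lift
    {i : ρA.toContRepresentation →ⁱL ρB.toContRepresentation} {n : ℕ}
    (hrange : ∀ b : B, n • b = 0 → ∃ a : A, i a = b) (hinj : Function.Injective i)
    (hA : ∀ a : A, n • a = 0)
    (hlift : ∀ y : B, (∀ τ ∈ absInertia F, ρB τ y = y) →
      (∀ σ : absoluteGaloisGroup F, ∃ z : B, (∀ τ ∈ absInertia F, ρB τ z = z) ∧ ρB σ y - y = n • z) →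
      ∃ m : B, (∀ σ : absoluteGaloisGroup F, ρB σ m = m) ∧
        ∃ z : B, (∀ τ ∈ absInertia F, ρB τ z = z) ∧ y - m = n • z)
    (φ : contOneCocycles ρA.toTopRep) {b : B}
    (hb : ∀ τ ∈ absInertia F, i (φ.1 τ) = ρB τ b - b) :
    oneCocycleClass ρA.toTopRep φ ∈
      DiscreteGaloisModule.unramifiedSubgroup ρA 1 ⊔ (galoisCohomology.map i 1).ker := by
  obtain ⟨b', hb', hbn'⟩ := exists_principal_witness_nsmul_fixed_of_lift hA hlift φ hb
  exact mem_unramifiedSubgroup_sup_ker_map_of_principal_on_absInertia_of_nsmul_fixed hrange hinj φ hb' hbn'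

/-- **THE DOOR WITH A LIFT: `H¹(i)⁻¹(H¹_ur(F, B)) = H¹_ur(F, A) ⊔ ker H¹(i)`** for `i : A ↪ B` injective intertwining,
`A` killed by `n`, `range i ⊇ B[n]`, under the lift hypothesis «every `I_F`-fixed `y ∈ B` with `Γ_F`-fixed class in
`B^{I_F} / n • B^{I_F}` is congruent to a `Γ_F`-fixed point modulo `n • B^{I_F}`» — no condition on the reduction type when
`B = E[p^∞]`. (`⊇` is n1011's unconditional `unramifiedSubgroup_sup_ker_le_comap_map_unramifiedSubgroup`.)
[cite: MilneADT2006, Ch. I §2 and Prop. 3.8] [cite: GreenbergLNM1716, §2, pp. 72–74] -/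
theorem comap_map_unramifiedSubgroup_eq_sup_ker_of_lift
    {i : ρA.toContRepresentation →ⁱL ρB.toContRepresentation} {n : ℕ}
    (hrange : ∀ b : B, n • b = 0 → ∃ a : A, i a = b) (hinj : Function.Injective i)
    (hA : ∀ a : A, n • a = 0)
    (hlift : ∀ y : B, (∀ τ ∈ absInertia F, ρB τ y = y) →
      (∀ σ : absoluteGaloisGroup F, ∃ z : B, (∀ τ ∈ absInertia F, ρB τ z = z) ∧ ρB σ y - y = n • z) →
      ∃ m : B, (∀ σ : absoluteGaloisGroup F, ρB σ m = m) ∧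
        ∃ z : B, (∀ τ ∈ absInertia F, ρB τ z = z) ∧ y - m = n • z) :
    (DiscreteGaloisModule.unramifiedSubgroup ρB 1).comap (galoisCohomology.map i 1) =
      DiscreteGaloisModule.unramifiedSubgroup ρA 1 ⊔ (galoisCohomology.map i 1).ker := by
  refine le_antisymm (fun c hc ↦ ?_) (unramifiedSubgroup_sup_ker_le_comap_map_unramifiedSubgroup i)
  obtain ⟨φ, rfl⟩ := oneCocycleClass_surjective _ c
  rw [AddSubgroup.mem_comap, galoisCohomology.map_one_oneCocycleClass] at hc
  obtain ⟨b, hb⟩ := (LocBridge.mem_unramifiedSubgroup_one_iff_exists ρB _).mp hc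
  exact mem_unramifiedSubgroup_sup_ker_map_of_principal_on_absInertia_of_lift hrange hinj hA hlift φ hb

/-- **n1011's inertia-torsion hypothesis implies the lift hypothesis** (with `m = y`, `z = 0`): if every `I_F`-fixed
point is killed by `n`, then `n • B^{I_F} = 0`, so an `I_F`-fixed `y` with `σ y − y ∈ n • B^{I_F}` is already `Γ_F`-fixed.
Hence `Additive.comap_map_unramifiedSubgroup_eq_sup_ker_of_inertia_torsion` is the special case of the door above. [folklore] -/
theorem lift_of_inertia_torsion {n : ℕ}
    (hI : ∀ b : B, (∀ τ ∈ absInertia F, ρB τ b = b) → n • b = 0) :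
    ∀ y : B, (∀ τ ∈ absInertia F, ρB τ y = y) →
      (∀ σ : absoluteGaloisGroup F, ∃ z : B, (∀ τ ∈ absInertia F, ρB τ z = z) ∧ ρB σ y - y = n • z) →
      ∃ m : B, (∀ σ : absoluteGaloisGroup F, ρB σ m = m) ∧
        ∃ z : B, (∀ τ ∈ absInertia F, ρB τ z = z) ∧ y - m = n • z := by
  intro y _ hy
  refine ⟨y, fun σ ↦ ?_, 0, fun τ _ ↦ by rw [map_zero], by rw [sub_self, smul_zero]⟩
  obtain ⟨z, hz, hσ⟩ := hy σ
  rw [hI z hz] at hσ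
  exact sub_eq_zero.mp hσ

/-- Sanity (the special case recovered): n1011's door from the door with a lift. -/
example {i : ρA.toContRepresentation →ⁱL ρB.toContRepresentation} {n : ℕ}
    (hrange : ∀ b : B, n • b = 0 → ∃ a : A, i a = b) (hinj : Function.Injective i)
    (hA : ∀ a : A, n • a = 0)
    (hI : ∀ b : B, (∀ τ ∈ absInertia F, ρB τ b = b) → n • b = 0) :
    (DiscreteGaloisModule.unramifiedSubgroup ρB 1).comap (galoisCohomology.map i 1) =
      DiscreteGaloisModule.unramifiedSubgroup ρA 1 ⊔ (galoisCohomology.map i 1).ker :=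
  comap_map_unramifiedSubgroup_eq_sup_ker_of_lift hrange hinj hA (lift_of_inertia_torsion hI)

end Summit.BirchSwinnertonDyer.BirchSwinnertonDyer.Theorems.ErratumRoadFiveKatoFframeDoorLift

end
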